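import Literature.Analysis.FluidPDE.CKN1982SettingProofs
import Literature.Analysis.FluidPDE.CKNMorreyBootstrapDual
import Literature.Analysis.FluidPDE.CKNMorreyLemma136Holds
import Literature.Analysis.FluidPDE.CKNMorreyLemmasHolds
import HarnessLib

/-!
# Discharge of the named fact `proposition2`

Topic `Literature/Analysis/FluidPDE`; proofs-only file (no definitions, no new named facts). The
named fact
`Literature.Analysis.FluidPDE.CKN1982.proposition2` (`CKN1982Setting.lean:158`)
is closed by ONE TERM from results already in the tree: the accepted reduction
`Literature.Analysis.FluidPDE.CKN1982.proposition2_of_lemmas` (`CKN1982SettingProofs.lean:127`)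
applied to the accepted unconditional discharges `lemma13_4_holds`, `lemma13_5_holds`,
`lemma13_6_holds` of its hypotheses.
Found by the librarian's forward-chaining census (sweep g29, 2026-08-16): the reduction and the
last of its inputs landed in
different units, so nobody had written the closing line.
-/

namespace Literature.Analysis.FluidPDE.CKN1982

/-- **`proposition2` holds**: the reduction `proposition2_of_lemmas` applied to `lemma13_4_holds`,
`lemma13_5_holds`, `lemma13_6_holds`. [folklore] -/
theorem proposition2_holds :
    _root_.Literature.Analysis.FluidPDE.CKN1982.proposition2 :=
  _root_.Literature.Analysis.FluidPDE.CKN1982.proposition2_of_lemmas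
    _root_.Literature.Analysis.FluidPDE.LemarieRieusset2016.lemma13_4_holds
    _root_.Literature.Analysis.FluidPDE.LemarieRieusset2016.lemma13_5_holds
    _root_.Literature.Analysis.FluidPDE.LemarieRieusset2016.lemma13_6_holds

end Literature.Analysis.FluidPDE.CKN1982
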